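import Mathlib.Analysis.SpecialFunctions.Pow.Real
import HarnessLib

/-!
# Idea deltas for door U-d, deck 8: the √ρ REMOVAL GLUE for K-I8-8's assembly (lens-4 §gen 6, R1)

Cell ls-idea, typed for the desk by seat ls-idea-typ-1 from seat ls-idea-lens-4 gen 6's LEAN NOTE
`HOME/ls-idea-lens-4/Sketch_R1_removal.lean` sha16 f977f730622fb092 (84 lines, `lean check` rc 0,
0 sorries; referee B batch 51 PASS ×4 and B's own check CLEAN «hypotheses w, b ≥ 0 and a² ≤ w·b per
level are satisfiable and used, conclusion non-trivial»; cards/ls-idea-lens-4.md sha16 2d6f6e7440b6c6c5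
l.237–241). VERBATIM (namespace of the idea-delta decks; the finset Cauchy–Schwarz helper `private`).
A Literature-free deck (imports Mathlib only), companion of `PrimeLevelFamEdgeIdeaDeltasNewFamiliesDefs`
§2–§2‴ (K-I8-8 inputs) which it does not import.

WHAT IT SAYS (lens-4 R1 «removing a small-mass subfamily of levels is free at cost √ρ»). Index set `L`
of levels (a `Finset`), subfamily `E ⊆ L` (e.g. the W-COH-incompatible levels), per-level harmonic
mass `w N ≥ 0`, per-level first mollified moment `a N` (any sign), per-level second mollified moment
`b N ≥ 0`, and the WITHIN-LEVEL Cauchy–Schwarz `a N ^ 2 ≤ w N * b N` (i.e.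
`(∑ʰ_f ω_f x_f)² ≤ (∑ʰ_f ω_f)(∑ʰ_f ω_f x_f²)` — at prime level this is the tree's
`KMV2000.norm_sq_LhPQ_le_re`, `Literature/NumberTheory/LFunctions/KMVMollifierPositivityFloor.lean`).
Then `|∑_{N ∈ E} a N| ≤ √(∑_{N ∈ E} w N) · √(∑_{N ∈ L} b N)`, so if `E` has relative mass `ρ` and
the second moment over `L` is `≤ C·X`, the removed first-moment contribution is `≤ √(ρC)·X`.
Folklore (Cauchy–Schwarz twice + positivity of `b`); PROVED. No exceptional-zero statement is
touched: this is bookkeeping glue. «The programme SEARCHES and TYPES; no exceptional-zero theorem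
(no Landau–Siegel / Siegel-zero exclusion, no Theorem 1–2 of arXiv:2211.02515, no repaired
Margin232) is proved by ideation; typed ≠ proved» — the two inequalities below ARE proved and
assert nothing about L-functions.
-/

namespace Summit.Parity.GeneralizedHardyLittlewood.Theorems.PrimeLevelFamEdgeIdeaDeltas

open Finset

/-- Discrete Cauchy–Schwarz with square roots on a finset. [folklore] -/
private theorem sum_mul_le_sqrt_mul_sqrt {ι : Type*} (s : Finset ι) (f g : ι → ℝ) :
    ∑ i ∈ s, f i * g i ≤ Real.sqrt (∑ i ∈ s, f i ^ 2) * Real.sqrt (∑ i ∈ s, g i ^ 2) := by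
  have h := Finset.sum_mul_sq_le_sq_mul_sq s f g
  have hf : 0 ≤ ∑ i ∈ s, f i ^ 2 := Finset.sum_nonneg fun i _ => sq_nonneg _
  rw [← Real.sqrt_mul hf]
  calc ∑ i ∈ s, f i * g i ≤ |∑ i ∈ s, f i * g i| := le_abs_self _
    _ = Real.sqrt ((∑ i ∈ s, f i * g i) ^ 2) := (Real.sqrt_sq_eq_abs _).symm
    _ ≤ Real.sqrt ((∑ i ∈ s, f i ^ 2) * ∑ i ∈ s, g i ^ 2) := Real.sqrt_le_sqrt h

/-- **R1 (√ρ removal; lens-4 §gen 6, K-I8-8 assembly glue).** With per-level Cauchy–Schwarz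
`a N ^ 2 ≤ w N * b N` on `L`, nonnegative masses `w` and second moments `b`, and `E ⊆ L`:
`|∑_{N∈E} a N| ≤ √(∑_{N∈E} w N) * √(∑_{N∈L} b N)`. The harmonic-weight instance is
`a N = ω-mass_N·𝔼^h_N[L·M]`, `w N = ω-mass_N`, `b N = ω-mass_N·𝔼^h_N[|L·M|²]` (the within-level
inequality is `KMV2000.norm_sq_LhPQ_le_re`). [folklore] -/
theorem abs_sum_le_sqrt_mass_mul_sqrt_second {ι : Type*} (L E : Finset ι) (hEL : E ⊆ L)
    (w a b : ι → ℝ) (hw : ∀ N ∈ L, 0 ≤ w N) (hb : ∀ N ∈ L, 0 ≤ b N)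
    (hcs : ∀ N ∈ L, a N ^ 2 ≤ w N * b N) :
    |∑ N ∈ E, a N| ≤ Real.sqrt (∑ N ∈ E, w N) * Real.sqrt (∑ N ∈ L, b N) := by
  -- step 1: triangle inequality
  have h1 : |∑ N ∈ E, a N| ≤ ∑ N ∈ E, |a N| := Finset.abs_sum_le_sum_abs _ _
  -- step 2: per-level Cauchy–Schwarz  |a N| ≤ √(w N) * √(b N)
  have h2 : ∀ N ∈ E, |a N| ≤ Real.sqrt (w N) * Real.sqrt (b N) := by
    intro N hN
    have hNL : N ∈ L := hEL hN
    rw [← Real.sqrt_mul (hw N hNL), ← Real.sqrt_sq_eq_abs]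
    exact Real.sqrt_le_sqrt (hcs N hNL)
  have h3 : ∑ N ∈ E, |a N| ≤ ∑ N ∈ E, Real.sqrt (w N) * Real.sqrt (b N) :=
    Finset.sum_le_sum h2
  -- step 3: Cauchy–Schwarz over E, then (√w)² = w, (√b)² = b
  have h4 : ∑ N ∈ E, Real.sqrt (w N) * Real.sqrt (b N)
      ≤ Real.sqrt (∑ N ∈ E, w N) * Real.sqrt (∑ N ∈ E, b N) := by
    have h := sum_mul_le_sqrt_mul_sqrt E (fun N => Real.sqrt (w N)) (fun N => Real.sqrt (b N))
    have hw' : ∑ N ∈ E, Real.sqrt (w N) ^ 2 = ∑ N ∈ E, w N :=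
      Finset.sum_congr rfl fun N hN => Real.sq_sqrt (hw N (hEL hN))
    have hb' : ∑ N ∈ E, Real.sqrt (b N) ^ 2 = ∑ N ∈ E, b N :=
      Finset.sum_congr rfl fun N hN => Real.sq_sqrt (hb N (hEL hN))
    simpa [hw', hb'] using h
  -- step 4: enlarge E to L in the second factor (b ≥ 0)
  have h5 : Real.sqrt (∑ N ∈ E, b N) ≤ Real.sqrt (∑ N ∈ L, b N) :=
    Real.sqrt_le_sqrt (Finset.sum_le_sum_of_subset_of_nonneg hEL fun N hN _ => hb N hN)
  have h6 : Real.sqrt (∑ N ∈ E, w N) * Real.sqrt (∑ N ∈ E, b N)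
      ≤ Real.sqrt (∑ N ∈ E, w N) * Real.sqrt (∑ N ∈ L, b N) :=
    mul_le_mul_of_nonneg_left h5 (Real.sqrt_nonneg _)
  exact h1.trans (h3.trans (h4.trans h6))

/-- **R1, relative form** (the card's «removing a subfamily of relative mass `ρ` costs `√ρ`»): if
`∑_{E} w ≤ ρ * X` and `∑_{L} b ≤ C * X` with `0 ≤ ρ`, `0 ≤ C`, `0 ≤ X`, then
`|∑_{E} a| ≤ √(ρ C) * X`. [folklore] -/
theorem abs_sum_le_sqrt_rho_mul {ι : Type*} (L E : Finset ι) (hEL : E ⊆ L)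
    (w a b : ι → ℝ) (hw : ∀ N ∈ L, 0 ≤ w N) (hb : ∀ N ∈ L, 0 ≤ b N)
    (hcs : ∀ N ∈ L, a N ^ 2 ≤ w N * b N) {ρ C X : ℝ} (hρ : 0 ≤ ρ) (hC : 0 ≤ C) (hX : 0 ≤ X)
    (hmass : ∑ N ∈ E, w N ≤ ρ * X) (hsec : ∑ N ∈ L, b N ≤ C * X) :
    |∑ N ∈ E, a N| ≤ Real.sqrt (ρ * C) * X := by
  have h := abs_sum_le_sqrt_mass_mul_sqrt_second L E hEL w a b hw hb hcs
  have h1 : Real.sqrt (∑ N ∈ E, w N) ≤ Real.sqrt (ρ * X) := Real.sqrt_le_sqrt hmass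
  have h2 : Real.sqrt (∑ N ∈ L, b N) ≤ Real.sqrt (C * X) := Real.sqrt_le_sqrt hsec
  have h3 : Real.sqrt (∑ N ∈ E, w N) * Real.sqrt (∑ N ∈ L, b N)
      ≤ Real.sqrt (ρ * X) * Real.sqrt (C * X) :=
    mul_le_mul h1 h2 (Real.sqrt_nonneg _) (Real.sqrt_nonneg _)
  have h4 : Real.sqrt (ρ * X) * Real.sqrt (C * X) = Real.sqrt (ρ * C) * X := by
    rw [← Real.sqrt_mul (mul_nonneg hρ hX), show ρ * X * (C * X) = (ρ * C) * (X * X) by ring,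
      Real.sqrt_mul (mul_nonneg hρ hC), Real.sqrt_mul_self hX]
  exact h.trans (h3.trans_eq h4)

end Summit.Parity.GeneralizedHardyLittlewood.Theorems.PrimeLevelFamEdgeIdeaDeltas
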